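import Mathlib
import Summits.NavierStokesRegularity.NavierStokesRegularity.Theorems.EulerZoomLiouvillePowerGaugeEulerLiouvilleSelfSimilarTopBadNodeHyperbolic
import HarnessLib.Audit

/-!
# Rung C1 of the crux `EulerZoomLiouville.PowerGaugeEulerLiouville`: the Bernoulli function near a
# stagnation arc — uniform second-order expansion and constancy along the arc

Route №10 `EulerZoomLiouville` (NavierStokesRegularity), crux E = stmt-NavierStokesRegularity-19832,
tenure rung C1 (exactly self-similar members), registered residue `stub_selfSimilarExtremal`.
Eighth file of the NODAL-CONTINUUM line (lineage ns-typeII-p1, gen 7): Bernoulli inputs of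
`…SelfSimilarTopBadNodeArc`, for a `C²` profile `(U, P)` (CIV 2026 (3.3); `V = γ(y−c) + U`, `ℋ` (3.30)):

* `selfSimilarBernoulli_expansion_near_of_curl_eq_zero` — **the second-order expansion
  `ℋ(z' + ξ) ≥ ℋ(z') + ½(2γ−1)⟪DV(z)ξ, ξ⟫ − ν|ξ|²` UNIFORMLY at the stagnation points `z'` near a
  non-vortical `z`** (two-point linearisation of `V` on a ball about `z`, tree `exists_ball_linearisation`;
  continuity of `DU`; symmetry of `DU(z)`; integrate along the segment);
* `selfSimilarBernoulli_const_on_arc` — `ℋ` is constant along a differentiable arc of stagnation points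
  (the nodal set is the critical set of `ℋ`, CIV (3.33)).

WHAT THIS IS NOT: not NS, not E, not rung C1 — calculus bookkeeping for classical profiles.
References: P. Constantin, M. Ignatova, V. Vicol, arXiv:2602.17570 (2026), §3.4.3 (3.29)–(3.33), §3.5.
[ConstantinIgnatovaVicol2026Putative]
-/

noncomputable section

-- flat `Theorems/<Route><Decl>…` files of one crux share the namespace of the crux (tree convention)
set_option linter.dupNamespace false

open Set Filter Topology Metric Function InnerProductSpace
open scoped RealInnerProductSpace NNReal

namespace Summit.NavierStokesRegularity.NavierStokesRegularity.Theorems.PowerGaugeEulerLiouville.NodalContinuum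

open Literature.Analysis Literature.Analysis.FluidPDE Literature.Analysis.ODE
open Summit.NavierStokesRegularity.NavierStokesRegularity.Theorems.PowerGaugeEulerLiouville.NodalFiniteness

variable {γ C : ℝ} {c : EuclideanSpace ℝ (Fin 3)}
  {U : EuclideanSpace ℝ (Fin 3) → EuclideanSpace ℝ (Fin 3)} {P : EuclideanSpace ℝ (Fin 3) → ℝ}

/-! ### The Bernoulli expansion, uniformly at nearby stagnation points -/

/-- **Second-order expansion of `ℋ`, uniformly at the stagnation points near a non-vortical node** `z`
(`curl U(z) = 0`, `A = DV(z)`): for every `ν > 0` there is `δ > 0` with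
`ℋ(z' + ξ) ≥ ℋ(z') + ½(2γ−1)⟪Aξ, ξ⟫ − ν|ξ|²` for every stagnation point `|z' − z| ≤ δ` and `|ξ| ≤ δ`
(as `selfSimilarBernoulli_expansion_of_curl_eq_zero`, with the two-point linearisation about `z`).
[cite: ConstantinIgnatovaVicol2026Putative, §3.4.3 eq. (3.29)–(3.31) (second variation near a node; not in print)] -/
theorem selfSimilarBernoulli_expansion_near_of_curl_eq_zero (h : IsSelfSimilarEulerProfile γ c U P)
    {z : EuclideanSpace ℝ (Fin 3)} (hΩz : curl U z = 0) {ν : ℝ} (hν : 0 < ν) :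
    ∃ δ > 0, ∀ z' ∈ selfSimilarNodalSet γ c U, ‖z' - z‖ ≤ δ →
      ∀ ζ : EuclideanSpace ℝ (Fin 3), ‖ζ‖ ≤ δ →
        selfSimilarBernoulli γ c U P z' +
            (1 / 2 * ((2 * γ - 1) * ⟪fderiv ℝ (selfSimilarTransport γ c U) z ζ, ζ⟫) - ν * ‖ζ‖ ^ 2) ≤
          selfSimilarBernoulli γ c U P (z' + ζ) := by
  set V := selfSimilarTransport γ c U with hV
  set A := fderiv ℝ V z with hAdef
  set Hb := selfSimilarBernoulli γ c U P with hHb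
  have hUd : Differentiable ℝ U := h.differentiable_velocity
  have hS := isSymmetric_fderiv_of_curl_eq_zero (hUd z) hΩz
  -- parameters
  set ρ : ℝ := min 1 (ν / (2 * (|2 * γ - 1| + 1))) with hρ
  have hρpos : 0 < ρ := lt_min one_pos (by positivity)
  have hρ1 : ρ ≤ 1 := min_le_left _ _
  have hρν : |2 * γ - 1| * ρ ≤ ν / 2 := by
    have h1 : ρ ≤ ν / (2 * (|2 * γ - 1| + 1)) := min_le_right _ _
    have h2 : |2 * γ - 1| * ρ ≤ |2 * γ - 1| * (ν / (2 * (|2 * γ - 1| + 1))) :=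
      mul_le_mul_of_nonneg_left h1 (abs_nonneg _)
    have h3 : |2 * γ - 1| * (ν / (2 * (|2 * γ - 1| + 1))) ≤ ν / 2 := by
      rw [show |2 * γ - 1| * (ν / (2 * (|2 * γ - 1| + 1))) =
        ν / 2 * (|2 * γ - 1| / (|2 * γ - 1| + 1)) by field_simp]
      have : |2 * γ - 1| / (|2 * γ - 1| + 1) ≤ 1 := by
        rw [div_le_one (by positivity)]; linarith
      calc ν / 2 * (|2 * γ - 1| / (|2 * γ - 1| + 1)) ≤ ν / 2 * 1 :=
            mul_le_mul_of_nonneg_left this (by linarith)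
        _ = ν / 2 := mul_one _
    exact h2.trans h3
  set κ : ℝ := ν / (4 * (‖A‖ + 2)) with hκ
  have hκpos : 0 < κ := by positivity
  obtain ⟨δ₁, hδ₁, hlin⟩ := exists_ball_linearisation h z hρpos
  have hDUc : ContinuousAt (fun y => fderiv ℝ U y) z :=
    (h.contDiff_velocity.continuous_fderiv (by norm_num)).continuousAt
  obtain ⟨δ₂, hδ₂, hDU⟩ := Metric.continuousAt_iff.1 hDUc κ hκpos
  set δ : ℝ := min (δ₁ / 2) (δ₂ / 4) with hδ
  have hδpos : 0 < δ := lt_min (by linarith) (by linarith)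
  have hδ1 : δ ≤ δ₁ / 2 := min_le_left _ _
  have hδ2 : δ ≤ δ₂ / 4 := min_le_right _ _
  refine ⟨δ, hδpos, fun z' hz' hz'z ζ hζ => ?_⟩
  have hVz' : V z' = 0 := hz'
  -- points on the segment stay in the balls about `z`
  have hsegnorm : ∀ s ∈ Icc (0 : ℝ) 1, ‖s • ζ‖ ≤ δ := by
    intro s hs
    rw [norm_smul, Real.norm_eq_abs, abs_of_nonneg hs.1]
    calc s * ‖ζ‖ ≤ 1 * ‖ζ‖ := mul_le_mul_of_nonneg_right hs.2 (norm_nonneg _)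
      _ ≤ δ := by rw [one_mul]; exact hζ
  have hmem1 : ∀ s ∈ Icc (0 : ℝ) 1, z' + s • ζ ∈ closedBall z δ₁ := by
    intro s hs
    rw [mem_closedBall, dist_eq_norm, show z' + s • ζ - z = (z' - z) + s • ζ by abel]
    calc ‖(z' - z) + s • ζ‖ ≤ ‖z' - z‖ + ‖s • ζ‖ := norm_add_le _ _
      _ ≤ δ + δ := add_le_add hz'z (hsegnorm s hs)
      _ ≤ δ₁ := by linarith
  have hz'mem : z' ∈ closedBall z δ₁ := by
    rw [mem_closedBall, dist_eq_norm]; linarith [hz'z]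
  have hE : ∀ s ∈ Icc (0 : ℝ) 1, ‖V (z' + s • ζ) - A (s • ζ)‖ ≤ ρ * (s * ‖ζ‖) := by
    intro s hs
    have := hlin (z' + s • ζ) (hmem1 s hs) z' hz'mem
    rw [← hV, ← hAdef, hVz', sub_zero, add_sub_cancel_left] at this
    rw [norm_smul, Real.norm_eq_abs, abs_of_nonneg hs.1] at this
    exact this
  have hVn : ∀ s ∈ Icc (0 : ℝ) 1, ‖V (z' + s • ζ)‖ ≤ (‖A‖ + ρ) * (s * ‖ζ‖) := by
    intro s hs
    have h1 := hE s hs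
    have h2 : ‖A (s • ζ)‖ ≤ ‖A‖ * (s * ‖ζ‖) := by
      have := A.le_opNorm (s • ζ)
      rwa [norm_smul, Real.norm_eq_abs, abs_of_nonneg hs.1] at this
    calc ‖V (z' + s • ζ)‖ = ‖A (s • ζ) + (V (z' + s • ζ) - A (s • ζ))‖ := by rw [add_sub_cancel]
      _ ≤ ‖A (s • ζ)‖ + ‖V (z' + s • ζ) - A (s • ζ)‖ := norm_add_le _ _
      _ ≤ ‖A‖ * (s * ‖ζ‖) + ρ * (s * ‖ζ‖) := add_le_add h2 h1
      _ = (‖A‖ + ρ) * (s * ‖ζ‖) := by ring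
  have hDUs : ∀ s ∈ Icc (0 : ℝ) 1, ‖fderiv ℝ U (z' + s • ζ) - fderiv ℝ U z‖ ≤ κ := by
    intro s hs
    have hd : dist (z' + s • ζ) z < δ₂ := by
      rw [dist_eq_norm, show z' + s • ζ - z = (z' - z) + s • ζ by abel]
      calc ‖(z' - z) + s • ζ‖ ≤ ‖z' - z‖ + ‖s • ζ‖ := norm_add_le _ _
        _ ≤ δ + δ := add_le_add hz'z (hsegnorm s hs)
        _ < δ₂ := by linarith
    have := hDU hd
    rw [dist_eq_norm] at this
    exact this.le
  -- the function along the segment and its derivative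
  set g : ℝ → ℝ := fun s => Hb (z' + s • ζ) with hg
  set q : ℝ := (2 * γ - 1) * ⟪A ζ, ζ⟫ - 2 * ν * ‖ζ‖ ^ 2 with hq
  have hHd : Differentiable ℝ Hb := h.contDiff_selfSimilarBernoulli.differentiable one_ne_zero
  have hg' : ∀ s, HasDerivAt g (fderiv ℝ Hb (z' + s • ζ) ζ) s := by
    intro s
    have hpath : HasDerivAt (fun s : ℝ => z' + s • ζ) ζ s := by
      have := ((hasDerivAt_id s).smul_const ζ).const_add z'
      simpa using this
    exact (hHd (z' + s • ζ)).hasFDerivAt.comp_hasDerivAt s hpath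
  have hlow : ∀ s ∈ Ioo (0 : ℝ) 1, s * q ≤ fderiv ℝ Hb (z' + s • ζ) ζ := by
    intro s hs
    have hs' : s ∈ Icc (0 : ℝ) 1 := ⟨hs.1.le, hs.2.le⟩
    set y := z' + s • ζ with hy
    rw [h.fderiv_selfSimilarBernoulli_apply y ζ]
    set Es := V y - A (s • ζ) with hEs
    have hEsn : ‖Es‖ ≤ ρ * (s * ‖ζ‖) := hE s hs'
    have hVy : V y = s • A ζ + Es := by rw [hEs, map_smul]; abel
    set T : ℝ := s * ‖ζ‖ * ‖ζ‖ with hT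
    have hTnn : 0 ≤ T := mul_nonneg (mul_nonneg hs.1.le (norm_nonneg _)) (norm_nonneg _)
    have h1 : (2 * γ - 1) * (s * ⟪A ζ, ζ⟫) - |2 * γ - 1| * ρ * T ≤ (2 * γ - 1) * ⟪V y, ζ⟫ := by
      rw [hVy, inner_add_left, inner_smul_left]
      simp only [conj_trivial]
      have hb : |⟪Es, ζ⟫| ≤ ρ * T := by
        rw [hT, show ρ * (s * ‖ζ‖ * ‖ζ‖) = ρ * (s * ‖ζ‖) * ‖ζ‖ by ring]
        exact (abs_real_inner_le_norm _ _).trans (mul_le_mul_of_nonneg_right hEsn (norm_nonneg _))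
      have hprod : |(2 * γ - 1) * ⟪Es, ζ⟫| ≤ |2 * γ - 1| * (ρ * T) := by
        rw [abs_mul]; exact mul_le_mul_of_nonneg_left hb (abs_nonneg _)
      have := neg_abs_le ((2 * γ - 1) * ⟪Es, ζ⟫)
      nlinarith [this, hprod]
    have h2 : -(2 * (‖A‖ + ρ) * κ * T) ≤ ⟪V y, fderiv ℝ U y ζ⟫ - ⟪fderiv ℝ U y (V y), ζ⟫ := by
      have hsymm : ⟪V y, fderiv ℝ U z ζ⟫ = ⟪fderiv ℝ U z (V y), ζ⟫ := by
        have := hS (V y) ζ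
        simp only [ContinuousLinearMap.coe_coe] at this
        rw [this]
      have e : ⟪V y, fderiv ℝ U y ζ⟫ - ⟪fderiv ℝ U y (V y), ζ⟫ =
          ⟪V y, (fderiv ℝ U y - fderiv ℝ U z) ζ⟫ - ⟪(fderiv ℝ U y - fderiv ℝ U z) (V y), ζ⟫ := by
        simp only [FunLike.coe_sub, Pi.sub_apply, inner_sub_left, inner_sub_right]
        linarith [hsymm]
      rw [e]
      set R := fderiv ℝ U y - fderiv ℝ U z with hR
      have hRn : ‖R‖ ≤ κ := hDUs s hs'
      have hVyn : ‖V y‖ ≤ (‖A‖ + ρ) * (s * ‖ζ‖) := hVn s hs'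
      have hb1 : |⟪V y, R ζ⟫| ≤ (‖A‖ + ρ) * κ * T := by
        calc |⟪V y, R ζ⟫| ≤ ‖V y‖ * ‖R ζ‖ := abs_real_inner_le_norm _ _
          _ ≤ ((‖A‖ + ρ) * (s * ‖ζ‖)) * (κ * ‖ζ‖) :=
              mul_le_mul hVyn ((R.le_opNorm ζ).trans (mul_le_mul_of_nonneg_right hRn (norm_nonneg _)))
                (norm_nonneg _) (mul_nonneg (add_nonneg (norm_nonneg _) hρpos.le)
                  (mul_nonneg hs.1.le (norm_nonneg _)))
          _ = (‖A‖ + ρ) * κ * T := by rw [hT]; ring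
      have hb2 : |⟪R (V y), ζ⟫| ≤ (‖A‖ + ρ) * κ * T := by
        calc |⟪R (V y), ζ⟫| ≤ ‖R (V y)‖ * ‖ζ‖ := abs_real_inner_le_norm _ _
          _ ≤ (κ * ((‖A‖ + ρ) * (s * ‖ζ‖))) * ‖ζ‖ :=
              mul_le_mul_of_nonneg_right ((R.le_opNorm _).trans
                (mul_le_mul hRn hVyn (norm_nonneg _) hκpos.le)) (norm_nonneg _)
          _ = (‖A‖ + ρ) * κ * T := by rw [hT]; ring
      have e1 := (abs_le.1 hb1).1
      have e2 := (abs_le.1 hb2).2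
      linarith
    have hbudget : |2 * γ - 1| * ρ + 2 * (‖A‖ + ρ) * κ ≤ 2 * ν := by
      have hA0 : 0 ≤ ‖A‖ := norm_nonneg _
      have h3 : 2 * (‖A‖ + ρ) * κ ≤ ν := by
        rw [hκ, show 2 * (‖A‖ + ρ) * (ν / (4 * (‖A‖ + 2))) = ν * ((‖A‖ + ρ) / (2 * (‖A‖ + 2))) by
          field_simp; ring]
        have : (‖A‖ + ρ) / (2 * (‖A‖ + 2)) ≤ 1 := by
          rw [div_le_one (by positivity)]; linarith
        calc ν * ((‖A‖ + ρ) / (2 * (‖A‖ + 2))) ≤ ν * 1 := mul_le_mul_of_nonneg_left this hν.le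
          _ = ν := mul_one _
      linarith
    have hTb : (|2 * γ - 1| * ρ + 2 * (‖A‖ + ρ) * κ) * T ≤ 2 * ν * T :=
      mul_le_mul_of_nonneg_right hbudget hTnn
    have e3 : s * q = (2 * γ - 1) * (s * ⟪A ζ, ζ⟫) - 2 * ν * T := by rw [hq, hT]; ring
    rw [e3]
    have e4 : (|2 * γ - 1| * ρ + 2 * (‖A‖ + ρ) * κ) * T =
        |2 * γ - 1| * ρ * T + 2 * (‖A‖ + ρ) * κ * T := by ring
    linarith [h1, h2, hTb, e4]
  set φ : ℝ → ℝ := fun s => g s - s ^ 2 / 2 * q with hφ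
  have hφ' : ∀ s, HasDerivAt φ (fderiv ℝ Hb (z' + s • ζ) ζ - s * q) s := by
    intro s
    have h1 : HasDerivAt (fun s : ℝ => s ^ 2 / 2 * q) (s * q) s := by
      have := ((hasDerivAt_pow 2 s).div_const 2).mul_const q
      refine this.congr_deriv ?_
      push_cast
      ring
    exact (hg' s).sub h1
  have hmono : MonotoneOn φ (Icc 0 1) := by
    refine monotoneOn_of_hasDerivWithinAt_nonneg (convex_Icc 0 1)
      (fun s _ => (hφ' s).continuousAt.continuousWithinAt) (fun s _ => (hφ' s).hasDerivWithinAt) ?_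
    intro s hs
    rw [interior_Icc] at hs
    linarith [hlow s hs]
  have h01 := hmono (left_mem_Icc.2 zero_le_one) (right_mem_Icc.2 zero_le_one) zero_le_one
  simp only [hφ, hg, zero_smul, add_zero, one_smul, one_pow] at h01
  simp only [hq] at h01
  norm_num at h01
  show Hb z' + (1 / 2 * ((2 * γ - 1) * ⟪A ζ, ζ⟫) - ν * ‖ζ‖ ^ 2) ≤ Hb (z' + ζ)
  linarith [h01]

/-! ### `ℋ` is constant along a stagnation arc -/

/-- **`ℋ` is constant along a differentiable arc of stagnation points** (`γ ≠ ½`): the nodal set is the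
critical set of `ℋ` (CIV (3.33), tree `fderiv_selfSimilarBernoulli_eq_zero_iff`), so `ℋ ∘ Γ` has zero
derivative. [cite: ConstantinIgnatovaVicol2026Putative, §3.4.3 eq. (3.33)] -/
theorem selfSimilarBernoulli_const_on_arc (h : IsSelfSimilarEulerProfile γ c U P) (hγ' : γ ≠ 1 / 2)
    {Γ Γ' : ℝ → EuclideanSpace ℝ (Fin 3)} (hΓ : ∀ τ, HasDerivAt Γ (Γ' τ) τ) {δ : ℝ}
    (harc : ∀ τ, |τ| ≤ δ → Γ τ ∈ selfSimilarNodalSet γ c U) {τ : ℝ} (hτ : |τ| ≤ δ) :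
    selfSimilarBernoulli γ c U P (Γ τ) = selfSimilarBernoulli γ c U P (Γ 0) := by
  have hHd : Differentiable ℝ (selfSimilarBernoulli γ c U P) :=
    h.contDiff_selfSimilarBernoulli.differentiable one_ne_zero
  set f : ℝ → ℝ := fun s => selfSimilarBernoulli γ c U P (Γ s) with hf
  have hf' : ∀ s, |s| ≤ δ → HasDerivAt f 0 s := by
    intro s hs
    have h1 : HasDerivAt f (fderiv ℝ (selfSimilarBernoulli γ c U P) (Γ s) (Γ' s)) s :=
      (hHd (Γ s)).hasFDerivAt.comp_hasDerivAt s (hΓ s)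
    rw [(h.fderiv_selfSimilarBernoulli_eq_zero_iff hγ' (Γ s)).2 (harc s hs),
      zero_apply] at h1
    exact h1
  have hδ : 0 ≤ δ := (abs_nonneg τ).trans hτ
  -- constant on `[-δ, δ]`
  have hcont : ContinuousOn f (Icc (-δ) δ) := fun s hs =>
    (hf' s (abs_le.2 ⟨by linarith [hs.1], hs.2⟩)).continuousAt.continuousWithinAt
  have hconst := constant_of_has_deriv_right_zero hcont
    (fun s hs => (hf' s (abs_le.2 ⟨by linarith [hs.1], hs.2.le⟩)).hasDerivWithinAt)
  have h1 := hconst τ ⟨(abs_le.1 hτ).1, (abs_le.1 hτ).2⟩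
  have h2 := hconst 0 ⟨by linarith, hδ⟩
  show f τ = f 0
  rw [h1, h2]

end Summit.NavierStokesRegularity.NavierStokesRegularity.Theorems.PowerGaugeEulerLiouville.NodalContinuum
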